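import Mathlib
import HarnessLib
import HarnessLib.Audit

/-!
# SoloInformed — formal periods of the category of `G`-graded finite sets (engine of Prop. VI)

This file computes, in the kernel, the SPACE OF FORMAL PERIODS of [Huber–Wüstholz 2022,
Def. 7.6] (= [Huber 2020, §3]) for an explicit family of `ℚ`-linear tensor categories with a
fibre functor to `(ℚ, ℚ)-Vect`.  It is the engine of `SoloInformedFormalPeriodRing.lean` and
`SoloInformedEffectiveModel.lean` (Proposition VI of the SoloInformed paper: inside the abstract
period formalism, the Period Conjecture for a localised category `C = C^eff[𝕃⁻¹]` does NOT imply
injectivity of `P̃(C^eff) → P̃(C)`; the period of the Lefschetz object can be a zero divisor of the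
effective formal period ring although the Period Conjecture holds after inverting it).

Fix a type `G` of "degrees" (later an additive commutative monoid).  The category `𝒞_G`:
* objects (`SoloInformedGrObj G`): finite sets `B` with a degree map `deg : B → G`
  (a homogeneous basis of a finite-dimensional `G`-graded `ℚ`-vector space);
* morphisms `X ⟶ Y` (`SoloInformedGrObj.Hom`): `ℚ`-matrices `mat : Y.B → X.B → ℚ` which are
  GRADED (`mat y x = 0` unless `deg y = deg x`); identity and composition (`Hom.id`, `Hom.comp`);
* the fibre functor `V : 𝒞_G → (ℚ, ℚ)-Vect`, `V(X) = (ℚ^B, ℚ^B, φ_X)` where — given a weight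
  `w : G →+ ℤ` and a unit `c ∈ ℂˣ` — the comparison `φ_X` is the diagonal matrix
  `c^{w(deg b)}` (graded matrices commute with it: `SoloInformedGrObj.Hom.mat_comm_comparison`,
  so `f ↦ (f, f)` is a morphism of `(ℚ, ℚ)-Vect` [HW22, Def. 7.1]);
* the tensor structure `X ⊗ Y = (X.B × Y.B, deg x + deg y)` (`tensor`), unit `line 0`.
`𝒞_G` ≃ finite-dimensional `G`-graded `ℚ`-vector spaces (comodules of the bialgebra `ℚ[G]`): a
`ℚ`-linear abelian tensor category on which `V` is faithful, exact and monoidal.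
The space of formal periods [HW22, Def. 7.6] with `K = L = ℚ`: the `ℚ`-vector space generated by
symbols `(X, σ, ω)`, `σ ∈ V(X) = ℚ^B`, `ω ∈ V(X)^∨ = ℚ^B` (pairing = dot product), modulo
BILINEARITY and FUNCTORIALITY `(X, σ, f^*ω) = (Y, f_*σ, ω)` for all `f : X ⟶ Y`
(`SoloInformedGrObj.FP G := (Sym G →₀ ℚ) ⧸ Rel G` — the relations are imposed verbatim).

Results (all KERNEL): `SoloInformedGrObj.cls_eq_sum` — every symbol reduces to line objects,
`⟦(X, σ, ω)⟧ = ∑_b σ_b ω_b · ⟦(𝟙_{deg b}, 1, 1)⟧`; `SoloInformedGrObj.fpEquiv : FP G ≃ₗ[ℚ] ℚ[G]` —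
the formal period space IS (the space underlying) the monoid algebra, i.e. Nori's coalgebra of
`𝒞_G` as predicted by [HW22, Thm. 7.18], `⟦(X, σ, ω)⟧ ↦ ∑_b σ_b ω_b [deg b]` (`fpEquiv_cls`), and
the `p_g = ⟦(𝟙_g, 1, 1)⟧` form a basis (`fpEquiv_gen`, `gen_injective`).  Ring structure,
evaluation map [HW22, Def. 7.11] and change of degrees: `SoloInformedFormalPeriodRing.lean`.

References: A. Huber, G. Wüstholz, *Transcendence and linear relations of 1-periods*, Cambridge
Tracts in Math. 227 (2022), Def. 7.1, 7.6, 7.11, Thm. 7.18; A. Huber, *Galois theory of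
periods*, Münster J. Math. 13 (2020), §3.
-/

noncomputable section

open scoped BigOperators

namespace Summit.KontsevichZagierPeriods.KontsevichZagierPeriods.Theorems

/-- An object of the category `𝒞_G`: a finite set `B` (a homogeneous basis) with degrees in `G`. -/
structure SoloInformedGrObj (G : Type) where
  /-- the finite basis -/
  B : Type
  [fintype : Fintype B]
  [decEq : DecidableEq B]
  /-- the degree of each basis vector -/
  deg : B → G

namespace SoloInformedGrObj

variable {G : Type}

/-- The basis of an object is a finite type. -/
instance instFintypeB (X : SoloInformedGrObj G) : Fintype X.B := X.fintype

/-- The basis of an object has decidable equality. -/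
instance instDecidableEqB (X : SoloInformedGrObj G) : DecidableEq X.B := X.decEq

/-- Morphisms `X ⟶ Y` of `𝒞_G`: graded `ℚ`-matrices. -/
structure Hom (X Y : SoloInformedGrObj G) where
  /-- the matrix entry (row `y`, column `x`) -/
  mat : Y.B → X.B → ℚ
  /-- graded: entries between different degrees vanish -/
  graded : ∀ y x, Y.deg y ≠ X.deg x → mat y x = 0

/-- `f_* : V(X) → V(Y)` (matrix times column vector). -/
def Hom.push {X Y : SoloInformedGrObj G} (f : Hom X Y) (σ : X.B → ℚ) : Y.B → ℚ :=
  fun y => ∑ x, f.mat y x * σ x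

/-- `f^* : V(Y)^∨ → V(X)^∨` (row vector times matrix). -/
def Hom.pull {X Y : SoloInformedGrObj G} (f : Hom X Y) (ω : Y.B → ℚ) : X.B → ℚ :=
  fun x => ∑ y, f.mat y x * ω y

/-- The identity morphism. -/
def Hom.id (X : SoloInformedGrObj G) : Hom X X where
  mat y x := if y = x then 1 else 0
  graded y x h := by
    by_cases hyx : y = x
    · exact absurd (congrArg X.deg hyx) h
    · simp [hyx]

/-- Composition of morphisms (matrix product); graded again. -/
def Hom.comp {X Y Z : SoloInformedGrObj G} (g : Hom Y Z) (f : Hom X Y) : Hom X Z where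
  mat z x := ∑ y, g.mat z y * f.mat y x
  graded z x h := by
    refine Finset.sum_eq_zero fun y _ => ?_
    by_cases h₁ : Z.deg z = Y.deg y
    · have h₂ : Y.deg y ≠ X.deg x := fun e => h (h₁.trans e)
      simp [f.graded y x h₂]
    · simp [g.graded z y h₁]

/-- Graded matrices commute with the comparison `φ = diag(c^{w ∘ deg})`: this is what makes
`X ↦ (ℚ^B, ℚ^B, φ_X)`, `f ↦ (f, f)` a functor to `(ℚ, ℚ)-Vect` [HW22, Def. 7.1]. -/
theorem Hom.mat_comm_comparison [AddZeroClass G] {X Y : SoloInformedGrObj G} (f : Hom X Y)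
    (w : G →+ ℤ) (c : ℂˣ) (y : Y.B) (x : X.B) :
    (f.mat y x : ℂ) * (c : ℂ) ^ w (X.deg x) = (c : ℂ) ^ w (Y.deg y) * f.mat y x := by
  by_cases h : Y.deg y = X.deg x
  · rw [h, mul_comm]
  · simp [f.graded y x h]

/-- The line object `𝟙_g`: one basis vector in degree `g`. -/
@[reducible] def line (g : G) : SoloInformedGrObj G where
  B := Unit
  deg := fun _ => g

/-- Tensor product of objects: product of bases, degrees add. -/
@[reducible] def tensor [Add G] (X Y : SoloInformedGrObj G) : SoloInformedGrObj G where
  B := X.B × Y.B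
  deg := fun p => X.deg p.1 + Y.deg p.2

/-- Symbols `(X, σ, ω)`: an object, a vector `σ ∈ V(X)`, a covector `ω ∈ V(X)^∨`. -/
def Sym (G : Type) : Type 1 := Σ X : SoloInformedGrObj G, (X.B → ℚ) × (X.B → ℚ)

/-- The symbol `(X, σ, ω)`. -/
def mkSym (X : SoloInformedGrObj G) (σ ω : X.B → ℚ) : Sym G := ⟨X, (σ, ω)⟩

/-- Tensor product of symbols `(X, σ, ω) ⊗ (Y, τ, η) = (X ⊗ Y, σ ⊗ τ, ω ⊗ η)`. -/
def Sym.tensor [Add G] (s s' : Sym G) : Sym G :=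
  mkSym (SoloInformedGrObj.tensor s.1 s'.1) (fun p => s.2.1 p.1 * s'.2.1 p.2)
    (fun p => s.2.2 p.1 * s'.2.2 p.2)

/-- The free `ℚ`-module on symbols. -/
abbrev Free (G : Type) : Type 1 := Sym G →₀ ℚ

/-- The generator of the free module attached to a symbol. -/
def fsym (X : SoloInformedGrObj G) (σ ω : X.B → ℚ) : Free G := Finsupp.single (mkSym X σ ω) 1

/-- The relations of [HW22, Def. 7.6]: bilinearity (four families) and functoriality. -/
def relSet (G : Type) : Set (Free G) :=
  {v | ∃ (X : SoloInformedGrObj G) (σ₁ σ₂ ω : X.B → ℚ),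
      v = fsym X (σ₁ + σ₂) ω - fsym X σ₁ ω - fsym X σ₂ ω} ∪
  {v | ∃ (X : SoloInformedGrObj G) (a : ℚ) (σ ω : X.B → ℚ),
      v = fsym X (a • σ) ω - a • fsym X σ ω} ∪
  {v | ∃ (X : SoloInformedGrObj G) (σ ω₁ ω₂ : X.B → ℚ),
      v = fsym X σ (ω₁ + ω₂) - fsym X σ ω₁ - fsym X σ ω₂} ∪
  {v | ∃ (X : SoloInformedGrObj G) (a : ℚ) (σ ω : X.B → ℚ),
      v = fsym X σ (a • ω) - a • fsym X σ ω} ∪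
  {v | ∃ (X Y : SoloInformedGrObj G) (f : Hom X Y) (σ : X.B → ℚ) (ω : Y.B → ℚ),
      v = fsym X σ (f.pull ω) - fsym Y (f.push σ) ω}

/-- The submodule of relations. -/
def Rel (G : Type) : Submodule ℚ (Free G) := Submodule.span ℚ (relSet G)

/-- The space of formal periods `P̃(𝒞_G)` [HW22, Def. 7.6]. -/
abbrev FP (G : Type) : Type 1 := Free G ⧸ Rel G

/-- The class `⟦(X, σ, ω)⟧` of a symbol in the space of formal periods. -/
def cls (X : SoloInformedGrObj G) (σ ω : X.B → ℚ) : FP G := Submodule.Quotient.mk (fsym X σ ω)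

/-- The class of a symbol given as a sigma type. -/
def clsSym (s : Sym G) : FP G := cls s.1 s.2.1 s.2.2

/-- A relation vanishes in the quotient. -/
theorem mk_eq_zero_of_mem_relSet {v : Free G} (h : v ∈ relSet G) :
    (Submodule.Quotient.mk v : FP G) = 0 :=
  (Submodule.Quotient.mk_eq_zero _).2 (Submodule.subset_span h)

/-! ### The relations, as identities in `FP G` -/

/-- Additivity in `σ`. -/
theorem cls_add_left (X : SoloInformedGrObj G) (σ₁ σ₂ ω : X.B → ℚ) :
    cls X (σ₁ + σ₂) ω = cls X σ₁ ω + cls X σ₂ ω := by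
  have h := mk_eq_zero_of_mem_relSet (G := G) (Or.inl (Or.inl (Or.inl (Or.inl ⟨X, σ₁, σ₂, ω, rfl⟩))))
  simp only [Submodule.Quotient.mk_sub] at h
  rw [sub_sub] at h
  exact sub_eq_zero.1 h

/-- Homogeneity in `σ`. -/
theorem cls_smul_left (X : SoloInformedGrObj G) (a : ℚ) (σ ω : X.B → ℚ) :
    cls X (a • σ) ω = a • cls X σ ω := by
  have h := mk_eq_zero_of_mem_relSet (G := G) (Or.inl (Or.inl (Or.inl (Or.inr ⟨X, a, σ, ω, rfl⟩))))
  simp only [Submodule.Quotient.mk_sub, Submodule.Quotient.mk_smul] at h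
  exact sub_eq_zero.1 h

/-- Additivity in `ω`. -/
theorem cls_add_right (X : SoloInformedGrObj G) (σ ω₁ ω₂ : X.B → ℚ) :
    cls X σ (ω₁ + ω₂) = cls X σ ω₁ + cls X σ ω₂ := by
  have h := mk_eq_zero_of_mem_relSet (G := G) (Or.inl (Or.inl (Or.inr ⟨X, σ, ω₁, ω₂, rfl⟩)))
  simp only [Submodule.Quotient.mk_sub] at h
  rw [sub_sub] at h
  exact sub_eq_zero.1 h

/-- Homogeneity in `ω`. -/
theorem cls_smul_right (X : SoloInformedGrObj G) (a : ℚ) (σ ω : X.B → ℚ) :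
    cls X σ (a • ω) = a • cls X σ ω := by
  have h := mk_eq_zero_of_mem_relSet (G := G) (Or.inl (Or.inr ⟨X, a, σ, ω, rfl⟩))
  simp only [Submodule.Quotient.mk_sub, Submodule.Quotient.mk_smul] at h
  exact sub_eq_zero.1 h

/-- FUNCTORIALITY: `⟦(X, σ, f^*ω)⟧ = ⟦(Y, f_*σ, ω)⟧`. -/
theorem cls_functorial {X Y : SoloInformedGrObj G} (f : Hom X Y) (σ : X.B → ℚ) (ω : Y.B → ℚ) :
    cls X σ (f.pull ω) = cls Y (f.push σ) ω := by
  have h := mk_eq_zero_of_mem_relSet (G := G) (Or.inr ⟨X, Y, f, σ, ω, rfl⟩)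
  simp only [Submodule.Quotient.mk_sub] at h
  exact sub_eq_zero.1 h

/-- `σ ↦ ⟦(X, σ, ω)⟧` is `ℚ`-linear. -/
def clsLeft (X : SoloInformedGrObj G) (ω : X.B → ℚ) : (X.B → ℚ) →ₗ[ℚ] FP G where
  toFun σ := cls X σ ω
  map_add' σ₁ σ₂ := cls_add_left X σ₁ σ₂ ω
  map_smul' a σ := cls_smul_left X a σ ω

/-- Unfolding of `clsLeft`. -/
theorem clsLeft_apply (X : SoloInformedGrObj G) (ω σ : X.B → ℚ) : clsLeft X ω σ = cls X σ ω := rfl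

/-! ### The generators: line objects -/

/-- The formal period `p_g = ⟦(𝟙_g, 1, 1)⟧` of the line object in degree `g`. -/
def gen (g : G) : FP G := cls (line g) (fun _ => 1) (fun _ => 1)

/-- The inclusion of the basis line through `b`: `𝟙_{deg b} ⟶ X`. -/
def lineIncl (X : SoloInformedGrObj G) (b : X.B) : Hom (line (X.deg b)) X where
  mat x _ := if x = b then 1 else 0
  graded x u h := by
    by_cases hx : x = b
    · subst hx; exact absurd rfl h
    · simp [hx]

/-- `(ι_b)_* 1 = e_b`. -/
theorem lineIncl_push (X : SoloInformedGrObj G) (b : X.B) :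
    (lineIncl X b).push (fun _ => 1) = Pi.single b 1 := by
  funext x
  by_cases hx : x = b
  · subst hx; simp [Hom.push, lineIncl]
  · simp [Hom.push, lineIncl, hx]

/-- `(ι_b)^* ω = ω_b`. -/
theorem lineIncl_pull (X : SoloInformedGrObj G) (b : X.B) (ω : X.B → ℚ) :
    (lineIncl X b).pull ω = fun _ => ω b := by
  funext u
  simp [Hom.pull, lineIncl]

/-- A basis vector paired with a covector is a multiple of a line generator. -/
theorem cls_single_left (X : SoloInformedGrObj G) (b : X.B) (ω : X.B → ℚ) :
    cls X (Pi.single b 1) ω = ω b • gen (X.deg b) := by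
  rw [← lineIncl_push, ← cls_functorial, lineIncl_pull]
  have : (fun _ : (line (X.deg b)).B => ω b) = ω b • (fun _ => (1 : ℚ)) := by
    funext u; simp
  rw [this, cls_smul_right]
  rfl

/-- REDUCTION: every symbol is a combination of line generators,
`⟦(X, σ, ω)⟧ = ∑_b σ_b ω_b · p_{deg b}`. -/
theorem cls_eq_sum (X : SoloInformedGrObj G) (σ ω : X.B → ℚ) :
    cls X σ ω = ∑ b, (σ b * ω b) • gen (X.deg b) := by
  have hσ : σ = ∑ b, σ b • (Pi.single b (1 : ℚ) : X.B → ℚ) := by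
    funext x
    simp [Finset.sum_apply, Pi.single_apply]
  have h1 : cls X σ ω = clsLeft X ω (∑ b, σ b • (Pi.single b (1 : ℚ) : X.B → ℚ)) := by
    rw [← hσ]; rfl
  rw [h1, map_sum]
  refine Finset.sum_congr rfl fun b _ => ?_
  rw [map_smul, clsLeft_apply, cls_single_left, smul_smul]

/-! ### The matrix-coefficient map `Φ : P̃(𝒞_G) → ℚ[G]` and its inverse -/

open AddMonoidAlgebra

/-- `single m` is additive (finite sums). -/
theorem single_finset_sum {ι : Type} (m : G) (s : Finset ι) (f : ι → ℚ) :
    AddMonoidAlgebra.single m (∑ i ∈ s, f i) = ∑ i ∈ s, AddMonoidAlgebra.single m (f i) :=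
  map_sum (AddMonoidAlgebra.singleAddHom m : ℚ →+ AddMonoidAlgebra ℚ G) f s

/-- The matrix coefficient of a symbol: `∑_b σ_b ω_b [deg b] ∈ ℚ[G]`. -/
def coefVec (s : Sym G) : AddMonoidAlgebra ℚ G :=
  ∑ b, AddMonoidAlgebra.single (s.1.deg b) (s.2.1 b * s.2.2 b)

/-- `coefVec` on `mkSym`. -/
theorem coefVec_mkSym (X : SoloInformedGrObj G) (σ ω : X.B → ℚ) :
    coefVec (mkSym X σ ω) = ∑ b, AddMonoidAlgebra.single (X.deg b) (σ b * ω b) := rfl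

/-- `Φ₀` on the free module. -/
def phi₀ : Free G →ₗ[ℚ] AddMonoidAlgebra ℚ G := Finsupp.linearCombination ℚ coefVec

/-- `Φ₀` on a symbol. -/
theorem phi₀_fsym (X : SoloInformedGrObj G) (σ ω : X.B → ℚ) :
    phi₀ (fsym X σ ω) = ∑ b, AddMonoidAlgebra.single (X.deg b) (σ b * ω b) := by
  simp [phi₀, fsym, Finsupp.linearCombination_single, coefVec_mkSym]

/-- The functoriality relation is killed by `Φ₀` (graded matrices!). -/
theorem phi₀_functorial {X Y : SoloInformedGrObj G} (f : Hom X Y) (σ : X.B → ℚ) (ω : Y.B → ℚ) :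
    phi₀ (fsym X σ (f.pull ω)) = phi₀ (fsym Y (f.push σ) ω) := by
  rw [phi₀_fsym, phi₀_fsym]
  simp only [Hom.pull, Hom.push, Finset.mul_sum, Finset.sum_mul, single_finset_sum]
  rw [Finset.sum_comm]
  refine Finset.sum_congr rfl fun y _ => Finset.sum_congr rfl fun x _ => ?_
  by_cases h : Y.deg y = X.deg x
  · rw [h]; congr 1; ring
  · simp [f.graded y x h]

/-- All relations lie in the kernel of `Φ₀`. -/
theorem rel_le_ker_phi₀ : Rel G ≤ LinearMap.ker (phi₀ (G := G)) := by
  unfold Rel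
  rw [Submodule.span_le]
  rintro v ((((⟨X, σ₁, σ₂, ω, rfl⟩ | ⟨X, a, σ, ω, rfl⟩) | ⟨X, σ, ω₁, ω₂, rfl⟩) | ⟨X, a, σ, ω, rfl⟩) |
    ⟨X, Y, f, σ, ω, rfl⟩)
  · simp only [SetLike.mem_coe, LinearMap.mem_ker, map_sub, phi₀_fsym, Pi.add_apply, add_mul,
      single_add, Finset.sum_add_distrib]
    abel
  · simp only [SetLike.mem_coe, LinearMap.mem_ker, map_sub, map_smul, phi₀_fsym, Pi.smul_apply,
      smul_eq_mul, Finset.smul_sum, smul_single', mul_assoc, sub_self]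
  · simp only [SetLike.mem_coe, LinearMap.mem_ker, map_sub, phi₀_fsym, Pi.add_apply, mul_add,
      single_add, Finset.sum_add_distrib]
    abel
  · simp only [SetLike.mem_coe, LinearMap.mem_ker, map_sub, map_smul, phi₀_fsym, Pi.smul_apply,
      smul_eq_mul, Finset.smul_sum, smul_single', mul_left_comm, sub_self]
  · simp only [SetLike.mem_coe, LinearMap.mem_ker, map_sub, phi₀_functorial, sub_self]

/-- `Φ : P̃(𝒞_G) → ℚ[G]`, the matrix-coefficient map. -/
def phi : FP G →ₗ[ℚ] AddMonoidAlgebra ℚ G := (Rel G).liftQ phi₀ rel_le_ker_phi₀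

/-- `Φ` on a symbol. -/
theorem phi_cls (X : SoloInformedGrObj G) (σ ω : X.B → ℚ) :
    phi (cls X σ ω) = ∑ b, AddMonoidAlgebra.single (X.deg b) (σ b * ω b) := by
  simp [phi, cls, Submodule.liftQ_apply, phi₀_fsym]

/-- `Φ(p_g) = [g]`. -/
@[simp] theorem phi_gen (g : G) : phi (gen g) = AddMonoidAlgebra.single g 1 := by
  simp [gen, phi_cls]

/-- `Ψ : ℚ[G] → P̃(𝒞_G)`, `[g] ↦ p_g`. -/
def psi : AddMonoidAlgebra ℚ G →ₗ[ℚ] FP G :=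
  (Finsupp.linearCombination ℚ (gen (G := G))) ∘ₗ (AddMonoidAlgebra.coeffLinearEquiv ℚ).toLinearMap

/-- `Ψ(r[g]) = r p_g`. -/
@[simp] theorem psi_single (g : G) (r : ℚ) : psi (AddMonoidAlgebra.single g r) = r • gen g := by
  simp [psi, Finsupp.linearCombination_single]

/-- `Φ ∘ Ψ = id`. -/
theorem phi_psi (y : AddMonoidAlgebra ℚ G) : phi (psi y) = y := by
  induction y using AddMonoidAlgebra.induction_linear with
  | zero => simp
  | add a b ha hb => simp [ha, hb]
  | single g r => simp

/-- `Ψ ∘ Φ = id` — i.e. the reduction `cls_eq_sum`. -/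
theorem psi_phi (x : FP G) : psi (phi x) = x := by
  induction x using Submodule.Quotient.induction_on with
  | H v =>
    induction v using Finsupp.induction_linear with
    | zero => simp
    | add a b ha hb =>
      simp only [Submodule.Quotient.mk_add, map_add] at *
      rw [ha, hb]
    | single s r =>
      obtain ⟨X, σ, ω⟩ := s
      have hs : (Finsupp.single (⟨X, (σ, ω)⟩ : Sym G) r : Free G) = r • fsym X σ ω := by
        rw [fsym, mkSym, Finsupp.smul_single', mul_one]
      rw [hs, Submodule.Quotient.mk_smul, map_smul, map_smul]
      change r • psi (phi (cls X σ ω)) = r • cls X σ ω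
      rw [phi_cls, map_sum]
      simp only [psi_single]
      rw [← cls_eq_sum]

/-- THE FORMAL PERIOD SPACE IS THE MONOID ALGEBRA: `P̃(𝒞_G) ≃ ℚ[G]` (as `ℚ`-vector spaces; for
the ring structure see `SoloInformedFormalPeriodRing.lean`). -/
def fpEquiv : FP G ≃ₗ[ℚ] AddMonoidAlgebra ℚ G :=
  LinearEquiv.ofLinear phi psi (LinearMap.ext phi_psi) (LinearMap.ext psi_phi)

/-- `fpEquiv ⟦(X, σ, ω)⟧ = ∑_b σ_b ω_b [deg b]` (the matrix coefficient). -/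
theorem fpEquiv_cls (X : SoloInformedGrObj G) (σ ω : X.B → ℚ) :
    fpEquiv (cls X σ ω) = ∑ b, AddMonoidAlgebra.single (X.deg b) (σ b * ω b) := phi_cls X σ ω

/-- `fpEquiv p_g = [g]`. -/
@[simp] theorem fpEquiv_gen (g : G) : fpEquiv (gen g) = AddMonoidAlgebra.single g 1 := phi_gen g

/-- `fpEquiv⁻¹ (r[g]) = r p_g`. -/
@[simp] theorem fpEquiv_symm_single (g : G) (r : ℚ) :
    fpEquiv.symm (AddMonoidAlgebra.single g r) = r • gen (G := G) g := psi_single g r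

/-- The line generators `p_g` are pairwise distinct … -/
theorem gen_injective : Function.Injective (gen (G := G)) := by
  intro g g' h
  have h' := congrArg fpEquiv h
  simp only [fpEquiv_gen] at h'
  exact (AddMonoidAlgebra.single_left_inj one_ne_zero).1 h'

/-- … and non-zero (indeed a basis, by `fpEquiv`). -/
theorem gen_ne_zero (g : G) : gen g ≠ 0 := by
  intro h
  have h' := congrArg fpEquiv h
  simp at h'

end SoloInformedGrObj

end Summit.KontsevichZagierPeriods.KontsevichZagierPeriods.Theorems
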